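import Summits.BirchSwinnertonDyer.Rank1Residual.SmallImageMu.EulerLossZero
import Summits.BirchSwinnertonDyer.Rank1Residual.SmallImageMu.MuDefectLeFineMu
import Literature.NumberTheory.EllipticCurves.IwasawaAlgebraMuQuotientProofs
import HarnessLib
import HarnessLib.Audit

/-!
# The Euler-loss chart read per package and per pair (kernel glue of ES-C7 `EulerLossZeroOnClassX9`, part 1):
# `μ^an = 0 ⟺ (δ = 0 ∧ μ(X) = μ(X₀))` per package; `k ≤ 0 ⟺ μ(X₀) ≤ δ`; per pair `μ^an = 0 ⟹ δ = 0`
# with NO named fact, and `μ^an = 0 ⟺ (δ = 0 ∧ e = 0)` modulo F1 + a modularity witness — theorems only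

HONEST FRAMING (cell `bsd-f3-mu`).  THEOREMS ONLY, sorry-free; CONDITIONAL, credits nothing; every
statement is conditional on the hypotheses displayed and/or on PUBLISHED named facts taken as binders
(`hfine` = F1 `Kato2004.exists_divisibilityInputs_fineQuotient`, `hmodP` = modularity
`nonempty_modularParametrizationData`).  Ported from the planner's checked `HOME/es/EulerLossChartExact.lean`
(«Sketch7», sha16 4b5b6c8384c6f496, rc 0, 0 sorry; -ref1 SURVIVES, -ref2 row es-§27) §2–§4 onto the
filed names (carrier `Rank1Residual.EulerLossZeroAt`, p575666; `μ`-bookkeeping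
`IwasawaAlgebraMuQuotientProofs`, p575673; the exact chart `mu_add_eulerLoss_eq` /
`muDefect_add_eulerLoss_eq` / `isTorsion_X_of_package` of `MuDefectLeFineMu.lean`, p569516), with ONE
strengthening the kernel checks: the cotorsion of `X(E/ℚ_∞)` that Sketch7 took from BCS 2025
Thm. 1.1.2 (a) is read off the package (Kato Thm. 17.4 (1)), so `μ^an = 0 ⟹ δ = 0` holds per pair with
no named-fact binder and the equivalence needs F1 + a modularity witness only.  Class-level edges
((c7a) 19630 ⟹ ES-C7, (c7b), (c7↔), (c7c) ES-C7 ⟹ ES-C2) are `EulerLossZeroEdges.lean`.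

* §0 on a package: `zetaModule_ne_bot` (`L_p ≠ 0 ⟹ Z ≠ 0`), `le_muInvariant_quotient_zetaModule`
  (`𝐇¹` free of rank one, `Z ≤ p^n 𝐇¹` ⟹ `n ≤ μ(𝐇¹/Z)`: Euler DEPTH ≤ Euler LOSS),
  `not_zetaModule_le_augIdealP_smul_top_of_eulerLossZeroAt` (`δ = 0` at the pair ⟹ no package has
  `Z ≤ p𝐇¹`).
* §1 per package: `muAn_eq_zero_iff`, `muDefect_nonpos_iff_fineMu_le_eulerLoss`,
  `muDefect_nonpos_iff_fineMu_eq_zero_of_eulerLoss_eq_zero` (on a `δ = 0` package the crux 20547 `k ≤ 0`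
  and statement (A) `μ(X₀) = 0` coincide).
* §2 per pair: `eulerLoss_eq_zero_and_mu_eq_of_muAnZeroAt`, `eulerLossZeroAt_of_muAnZeroAt` (no F1/BCS),
  `muLeFineMuAt_of_muAnZeroAt` (ES-C6's body WITHOUT 19629), `muAnZeroAt_iff_eulerLossZero_and_muLeFineMu`
  (+ `_X9`): **`μ^an(E,p) = 0 ⟺ (EulerLossZeroAt ∧ MuLeFineMuAt)`** — the lens's answer: the power of `p`
  lost by the Euler-system machinery at non-surjective image is `δ_Z` EXACTLY, and `μ^an = 0` iff nothing
  is lost (`δ = 0`) and `μ` is fine (`e = 0`).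
PARTITION: closes no class (X9 790 = 130 + 36 + 624; X10b 610 + 273); beyond-print theorem: NO.

References: [Kato2004Asterisque] Thm. 12.4 (p. 221), Thm. 12.5–12.6 (pp. 221–222), Thm. 17.4 (p. 273),
Prop. 17.11 (p. 277), §17.13 (pp. 279–280); [Kim2025RefinedTNC] Thm. 3.18; [GreenbergVatsal2000]
pp. 2–4 (1)–(3), Prop. 3.7; [Lang1990] Ch. 5 §§1–3; HOME MEMO-es.md §9, §27, es/EulerLossChartExact.lean.
-/

-- the summit and its single problem are both named `BirchSwinnertonDyer` (registry layout D-0017)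
set_option linter.dupNamespace false

noncomputable section

open scoped Classical MatrixGroups ModularForm NumberField
open CongruenceSubgroup WeierstrassCurve Field
open Literature.NumberTheory.GaloisRepresentations
open Literature.NumberTheory.EllipticCurves Literature.NumberTheory.EllipticCurves.ModularForms
open Literature.NumberTheory.EllipticCurves.Kato2004
open Literature.NumberTheory.EllipticCurves.Kato2004.EulerSystemValues
open Literature.NumberTheory.EllipticCurves.IwasawaDual
-- only the carriers from the Literature residual namespace (its census `ClassX9` must not shadow the
-- `μ`-version `Rank1ResidualX9Defs.ClassX9` used by the SmallImageMu nodes)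
open Literature.NumberTheory.EllipticCurves.Rank1Residual (MuAnZeroAt MuAlgZeroAt FineMuZeroAt
  MuDefectNonposAt KatoDivisibilityAt MuLeFineMuAt EulerLossZeroAt)
open Summit.BirchSwinnertonDyer.BirchSwinnertonDyer.Rank1Residual (ClassX9 AnalyticMuZeroOnClassX9)
open Module IwasawaAlgebra

namespace Summit.BirchSwinnertonDyer.Rank1Residual.SmallImageMu

universe u

/-! ## §0 The zeta module of a §17.13 package: non-zero; depth ≤ loss; `δ = 0` forbids `Z ≤ p𝐇¹` -/

section Package

variable {p : ℕ} [Fact p.Prime] {W : WeierstrassCurve ℚ} [W.IsElliptic] [W.IsGloballyMinimal]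
  [ContinuousSMul ℤ_[p] (W.tateModule p)] {N : ℕ} {f : CuspForm (Gamma0 N) 2}
  {κ : ZpExtension ℚ p} {γ : absoluteGaloisGroup ℚ}
  {I : IwasawaH1Data W p κ γ} {D : W.SelmerDualData κ γ}

/-- **The zeta module of a §17.13 package is non-zero** when `L_p(E,T) ≠ 0`: `col(loc Z) ∋ G = p^n · L_p`
(the package field `pow_mem`, Kato p. 279: from Prop. 17.11 and Thm. 16.6), and `ι G = p^n · L_p ≠ 0`.
[cite: Kato2004Asterisque, Thm. 12.6 (p. 222) and §17.13 (p. 279)] -/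
theorem zetaModule_ne_bot (K : DivisibilityInputs W p f κ γ I D)
    (hL : padicLFunction f (unitRoot W p : ℚ_[p]) ≠ 0) : K.Z ≠ ⊥ := by
  have hpP : p.Prime := Fact.out
  have hp0 : (p : ℚ_[p]) ≠ 0 := by exact_mod_cast hpP.ne_zero
  intro h0
  have hG : K.G ∈ Submodule.map (K.col ∘ₗ K.loc) K.Z := K.pow_mem
  rw [h0, Submodule.map_bot, Submodule.mem_bot] at hG
  have hιG := K.ιG_eq
  rw [hG, map_zero, eq_comm, mul_eq_zero] at hιG
  rcases hιG with h | h
  · simp only [map_eq_zero_iff _ (PowerSeries.C_injective), pow_eq_zero_iff', ne_eq] at h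
    exact hp0 h.1
  · exact hL h

/-- **Euler DEPTH ≤ Euler LOSS at a package**: with `𝐇¹` free of rank one (Kato Thm. 12.4 (3): `p ≠ 2`,
`E[p]` irreducible), `L_p(E,T) ≠ 0` and `Z ≤ p^n 𝐇¹`, `n ≤ μ(𝐇¹/Z)`
(`le_muInvariant_quotient_of_le_pow_smul_top` along `𝐇¹ ≅ Λ`).
[cite: Kato2004Asterisque, Thm. 12.4 (3) (p. 221) and Thm. 12.6 (p. 222)] -/
theorem le_muInvariant_quotient_zetaModule (K : DivisibilityInputs W p f κ γ I D)
    (hL : padicLFunction f (unitRoot W p : ℚ_[p]) ≠ 0)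
    [Module.Finite (IwasawaAlgebra p) I.H] [Module.Free (IwasawaAlgebra p) I.H]
    (hrank : Module.finrank (IwasawaAlgebra p) I.H = 1) {n : ℕ}
    (hZn : K.Z ≤ (augIdealP p ^ n) • (⊤ : Submodule (IwasawaAlgebra p) I.H)) :
    n ≤ muInvariant p (I.H ⧸ K.Z) := by
  obtain ⟨e⟩ := nonempty_linearEquiv_of_finrank_eq_one hrank
  exact le_muInvariant_quotient_of_le_pow_smul_top e.symm (zetaModule_ne_bot K hL) hZn

/-- **`δ = 0` at the pair ⟹ no package has its zeta module inside `p · 𝐇¹`** (granted `𝐇¹` free of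
rank one at the package and `L_p(E,T) ≠ 0`): the depth-`1` case of `le_muInvariant_quotient_zetaModule`.
The form in which ES-C7 meets the Thm. 12.6 span clause (`Z ≤ span{genuine classes}`) to give a genuine
class `∉ p𝐇¹` (edge (c7c)). [cite: Kato2004Asterisque, Thm. 12.4 (3) (p. 221), Thm. 12.6 (p. 222)] -/
theorem not_zetaModule_le_augIdealP_smul_top_of_eulerLossZeroAt (h : EulerLossZeroAt W p)
    (hκ : κ.IsCyclotomic) (hγ : κ.IsTopGenerator γ) (hγ' : IsCyclotomicVariable p γ) [NeZero N]
    (hf : IsNewformOf W f) (hL : padicLFunction f (unitRoot W p : ℚ_[p]) ≠ 0)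
    [Module.Finite (IwasawaAlgebra p) I.H] [Module.Free (IwasawaAlgebra p) I.H]
    (hrank : Module.finrank (IwasawaAlgebra p) I.H = 1) (K : DivisibilityInputs W p f κ γ I D) :
    ¬ K.Z ≤ augIdealP p • (⊤ : Submodule (IwasawaAlgebra p) I.H) := by
  intro hZ1
  have h1 : 1 ≤ muInvariant p (I.H ⧸ K.Z) :=
    le_muInvariant_quotient_zetaModule K hL hrank (n := 1) (by rwa [pow_one])
  have h0 : muInvariant p (I.H ⧸ K.Z) = 0 := h κ γ f hκ hγ hγ' hf I D K
  omega

end Package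

/-! ## §1 Per package: `μ^an = 0 ⟺ (δ = 0 ∧ μ(X) = μ(Y))`; `k ≤ 0 ⟺ μ(Y) ≤ δ` (from the tree chart) -/

section Chart

variable {p : ℕ} [Fact p.Prime] {W : WeierstrassCurve ℚ} [W.IsElliptic] [W.IsGloballyMinimal]
  [ContinuousSMul ℤ_[p] (W.tateModule p)] {N : ℕ} [NeZero N] {f : CuspForm (Gamma0 N) 2}
  {κ : ZpExtension ℚ p} {γ : absoluteGaloisGroup ℚ}
  {I : IwasawaH1Data W p κ γ} {D : W.SelmerDualData κ γ}
  {Y : Type u} [AddCommGroup Y] [Module (IwasawaAlgebra p) Y]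

omit [NeZero N] in
/-- **Per package, «`μ^an = 0`» is EXACTLY «Euler loss `0` ∧ `μ(X) = μ(Y)`»:**
`μ(Λ/(G₁)) = 0 ↔ (μ(𝐇¹/Z) = 0 ∧ μ(X) = μ(Y))` for a §17.13 package with `E[p]` irreducible,
`ι G₁ = L_p ≠ 0`, an exact fine quotient `π : X ↠ Y`, `X` f.g. torsion (`μ(Y) ≤ μ(X)` by the surjection;
the tree chart `mu_add_eulerLoss_eq`).  So, per pair and modulo F1, 19630's hypothesis `μ^an = 0` pins
`δ_Z = 0` AND `μ(X) = μ(X₀)`; conversely both together give `μ^an = 0`.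
[cite: Kato2004Asterisque, §17.13 (pp. 279–280)] -/
theorem muAn_eq_zero_iff (K : DivisibilityInputs W p f κ γ I D)
    (hirr : W.HasIrreducibleModPGaloisRep p) {G₁ : IwasawaAlgebra p}
    (hG₁ : iwasawaToPowerSeries p G₁ = padicLFunction f (unitRoot W p : ℚ_[p]))
    (hL : padicLFunction f (unitRoot W p : ℚ_[p]) ≠ 0)
    (π : D.X →ₗ[IwasawaAlgebra p] Y) (hπs : Function.Surjective π) (hπ : Function.Exact K.toX π)
    [Module.Finite (IwasawaAlgebra p) D.X] (hDt : D.IsTorsion) :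
    muInvariant p (IwasawaAlgebra p ⧸ Ideal.span {G₁}) = 0 ↔
      muInvariant p (I.H ⧸ K.Z) = 0 ∧ muInvariant p D.X = muInvariant p Y := by
  have h := mu_add_eulerLoss_eq K hirr hG₁ hL π hπs hπ hDt
  have hYle : muInvariant p Y ≤ muInvariant p D.X := muInvariant_le_of_surjective hDt π hπs
  constructor
  · intro h0
    rw [h0, zero_add] at h
    constructor <;> omega
  · rintro ⟨hd, he⟩
    rw [hd, he, add_zero] at h
    omega

/-- **Kato divisibility at the package ⟺ `μ(Y) ≤ δ_Z`**: `k ≤ 0 ↔ μ(Y) ≤ μ(𝐇¹/Z)` (the exact chart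
`k + δ_Z = μ(Y)`, tree `muDefect_add_eulerLoss_eq`).  Item 20547 (`k ≤ 0` on X9) asks, per pair and
package, that the fine `μ` be ABSORBED by the Euler loss; under ES-C7 (`δ_Z = 0`) it reads `μ(X₀) = 0`.
[cite: Kato2004Asterisque, Thm. 17.4 (3) (p. 273), §17.13 (pp. 279–280)] -/
theorem muDefect_nonpos_iff_fineMu_le_eulerLoss (K : DivisibilityInputs W p f κ γ I D)
    (hirr : W.HasIrreducibleModPGaloisRep p) (hord : IsOrdinaryAt W p) (hf : IsNewformOf W f)
    {G₁ : IwasawaAlgebra p}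
    (hG₁ : iwasawaToPowerSeries p G₁ = padicLFunction f (unitRoot W p : ℚ_[p]))
    (π : D.X →ₗ[IwasawaAlgebra p] Y) (hπs : Function.Surjective π) (hπ : Function.Exact K.toX π)
    [Module.Finite (IwasawaAlgebra p) D.X] (hDt : D.IsTorsion)
    {g : IwasawaAlgebra p} {k : ℤ} (hchar : D.charIdeal = Ideal.span {g})
    (hι : iwasawaToPowerSeries p g =
      PowerSeries.C ((p : ℚ_[p]) ^ k) * padicLFunction f (unitRoot W p : ℚ_[p])) :
    k ≤ 0 ↔ muInvariant p Y ≤ muInvariant p (I.H ⧸ K.Z) := by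
  have h := muDefect_add_eulerLoss_eq K hirr hord hf hG₁ π hπs hπ hDt hchar hι
  omega

/-- **Under `δ_Z = 0` at the package, Kato divisibility there ⟺ `μ(Y) = 0`** (`k ≤ 0 ↔ μ(Y) = 0`):
on an ES-C7 pair the crux 20547 and statement (A) (`μ(X₀) = 0`) coincide package by package.
[cite: Kato2004Asterisque, Thm. 17.4 (3) (p. 273), §17.13 (pp. 279–280)] -/
theorem muDefect_nonpos_iff_fineMu_eq_zero_of_eulerLoss_eq_zero (K : DivisibilityInputs W p f κ γ I D)
    (hirr : W.HasIrreducibleModPGaloisRep p) (hord : IsOrdinaryAt W p) (hf : IsNewformOf W f)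
    {G₁ : IwasawaAlgebra p}
    (hG₁ : iwasawaToPowerSeries p G₁ = padicLFunction f (unitRoot W p : ℚ_[p]))
    (π : D.X →ₗ[IwasawaAlgebra p] Y) (hπs : Function.Surjective π) (hπ : Function.Exact K.toX π)
    [Module.Finite (IwasawaAlgebra p) D.X] (hDt : D.IsTorsion)
    {g : IwasawaAlgebra p} {k : ℤ} (hchar : D.charIdeal = Ideal.span {g})
    (hι : iwasawaToPowerSeries p g =
      PowerSeries.C ((p : ℚ_[p]) ^ k) * padicLFunction f (unitRoot W p : ℚ_[p]))
    (hδ : muInvariant p (I.H ⧸ K.Z) = 0) :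
    k ≤ 0 ↔ muInvariant p Y = 0 := by
  rw [muDefect_nonpos_iff_fineMu_le_eulerLoss K hirr hord hf hG₁ π hπs hπ hDt hchar hι, hδ,
    Nat.le_zero]

end Chart

/-! ## §2 Per pair, in the carriers of `Rank1Residual.MuLambdaCarriers` / `EulerLossCarrier` -/

section PerPair

variable {p : ℕ} [Fact p.Prime] {W : WeierstrassCurve ℚ} [W.IsElliptic] [W.IsGloballyMinimal]
  [ContinuousSMul ℤ_[p] (W.tateModule p)]

/-- **`μ^an = 0` at the pair ⟹ EVERY package with an exact fine quotient has Euler loss `0` and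
`μ(X) = μ(Y)`** (no F1 needed: universal in the package; `X` f.g. torsion, `E[p]` irreducible).
[cite: Kato2004Asterisque, §17.13 (pp. 279–280)] [cite: GreenbergVatsal2000, pp. 3–4, (2)–(3)] -/
theorem eulerLoss_eq_zero_and_mu_eq_of_muAnZeroAt (hμ : MuAnZeroAt W p)
    {N : ℕ} [NeZero N] {f : CuspForm (Gamma0 N) 2} (hf : IsNewformOf W f)
    {κ : ZpExtension ℚ p} {γ : Field.absoluteGaloisGroup ℚ} {I : IwasawaH1Data W p κ γ}
    {D : W.SelmerDualData κ γ} (K : DivisibilityInputs W p f κ γ I D)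
    (hirr : W.HasIrreducibleModPGaloisRep p) {G₁ : IwasawaAlgebra p}
    (hG₁ : iwasawaToPowerSeries p G₁ = padicLFunction f (unitRoot W p : ℚ_[p]))
    {Y : Type u} [AddCommGroup Y] [Module (IwasawaAlgebra p) Y]
    (π : D.X →ₗ[IwasawaAlgebra p] Y) (hπs : Function.Surjective π) (hπ : Function.Exact K.toX π)
    [Module.Finite (IwasawaAlgebra p) D.X] (hDt : D.IsTorsion) :
    muInvariant p (I.H ⧸ K.Z) = 0 ∧ muInvariant p D.X = muInvariant p Y := by
  have hcert := hμ f hf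
  have hL : padicLFunction f (unitRoot W p : ℚ_[p]) ≠ 0 := by
    intro h
    obtain ⟨n, hn⟩ := hcert
    rw [h, map_zero, norm_zero] at hn
    exact zero_ne_one hn
  have hG𝔭 : G₁ ∉ augIdealP p := not_mem_augIdealP_of_norm_coeff_eq_one hG₁ hcert
  have h0 := muInvariant_quotient_span_eq_zero_of_not_mem hG𝔭
  exact (muAn_eq_zero_iff K hirr hG₁ hL π hπs hπ hDt).mp h0

/-- **`μ^an = 0` at the pair ⟹ `EulerLossZeroAt W p`** (every package Euler-primitive at `(p)`), at
`p ≠ 2` good ordinary with `E[p]` irreducible — NO F1, NO BCS: the package's own fine quotient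
`X ↠ X/(image of P)` serves as `Y`, and `X` is torsion from the package (Kato Thm. 17.4 (1), tree
`isTorsion_X_of_package`). [cite: Kato2004Asterisque, Thm. 17.4 (1) (p. 273), §17.13 (pp. 279–280)] -/
theorem eulerLossZeroAt_of_muAnZeroAt (hμ : MuAnZeroAt W p) (hp2 : p ≠ 2) (hord : IsOrdinaryAt W p)
    (hirr : W.HasIrreducibleModPGaloisRep p) : EulerLossZeroAt W p := by
  intro κ γ N _ f hκ hγ hγ' hf I D K
  haveI : Module.Finite (IwasawaAlgebra p) D.X :=
    WeierstrassCurve.SelmerDualData.module_finite_of_isCyclotomic W κ hκ D hγ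
  obtain ⟨G₁, hG₁⟩ := exists_iwasawaToPowerSeries_eq_padicLFunction hp2 hord hf hirr
  have hDt : D.IsTorsion := isTorsion_X_of_package K hord hf
  exact (eulerLoss_eq_zero_and_mu_eq_of_muAnZeroAt hμ hf K hirr hG₁
    (LinearMap.range K.toX).mkQ (Submodule.mkQ_surjective _) (LinearMap.exact_map_mkQ_range K.toX) hDt).1

/-- **`μ^an = 0` at the pair ⟹ `MuLeFineMuAt W p` («`e = 0`», ES-C6's body) — WITHOUT the core theorem /
19629 `KatoMuTransfer`**, granted F1 (plain form), `p ≠ 2` good ordinary, `E[p]` irreducible and a newform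
(`hmodP`); cotorsion from the package (NO BCS).  (The tree's (e1′) derived ES-C6 from 19629's `μ(X) = 0`;
here it is the `e`-half of the exact chart.) [cite: Kato2004Asterisque, Thm. 17.4 (1) (p. 273), §17.13 (pp. 279–280)] -/
theorem muLeFineMuAt_of_muAnZeroAt (hfine : exists_divisibilityInputs_fineQuotient)
    (hmodP : nonempty_modularParametrizationData) (hp2 : p ≠ 2) (hord : IsOrdinaryAt W p)
    (hirr : W.HasIrreducibleModPGaloisRep p) (hμ : MuAnZeroAt W p) :
    MuLeFineMuAt W p := by
  intro κ γ hκ hγ hγ' D Y _ _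
  haveI : NeZero (W.conductorNorm ℤ) := ⟨(W.conductorNorm_pos_holds).ne'⟩
  obtain ⟨Dm⟩ := hmodP W
  obtain ⟨I⟩ := Kato2004.nonempty_iwasawaH1Data_holds W p κ γ hκ hγ
  haveI : Module.Finite (IwasawaAlgebra p) D.X :=
    WeierstrassCurve.SelmerDualData.module_finite_of_isCyclotomic W κ hκ D hγ
  obtain ⟨K, π, hπs, hπ⟩ := hfine W p Dm.f κ γ hp2 hord hκ hγ hγ' Dm.isNewformOf I D Y
  obtain ⟨G₁, hG₁⟩ := exists_iwasawaToPowerSeries_eq_padicLFunction hp2 hord Dm.isNewformOf hirr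
  have hDt : D.IsTorsion := isTorsion_X_of_package K hord Dm.isNewformOf
  have h := (eulerLoss_eq_zero_and_mu_eq_of_muAnZeroAt hμ Dm.isNewformOf K hirr hG₁ π hπs hπ hDt).2
  show muInvariant p D.X ≤ muInvariant p Y.X
  exact h.le

/-- **THE LENS'S ANSWER, per pair (mod F1 and a modularity witness `hmodP`; `p ≠ 2` good ordinary,
`E[p]` irreducible — no other image hypothesis, no BCS): `μ^an(E, p) = 0 ⟺ (EulerLossZeroAt ∧ MuLeFineMuAt)`,**
i.e. the analytic `μ` vanishes iff EVERY §17.13 package is Euler-primitive at `(p)` (`δ = 0`, ES-C7's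
body) AND the `μ` of `E` over `ℚ_∞` is carried by the fine Selmer group (`e = 0`, ES-C6's body).
⟹ needs F1 only for `e`; ⟸ reads `μ^an` off the package of the canonical data via `muAn_eq_zero_iff`.
On the certified census (`μ^an = 0`: 834/848 X9 rows, README-X9-MU-TABLE-v1) BOTH conjuncts hold per
row; a refuting row for either needs `μ^an ≥ 1` (0 rows). [cite: Kato2004Asterisque, Thm. 17.4 (1) (p. 273), §17.13 (pp. 279–280)]
[cite: GreenbergVatsal2000, pp. 2–4, (1)–(3) and Prop. (3.7)] -/
theorem muAnZeroAt_iff_eulerLossZero_and_muLeFineMu (hfine : exists_divisibilityInputs_fineQuotient)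
    (hmodP : nonempty_modularParametrizationData) (hp2 : p ≠ 2) (hord : IsOrdinaryAt W p)
    (hirr : W.HasIrreducibleModPGaloisRep p) :
    MuAnZeroAt W p ↔ EulerLossZeroAt W p ∧ MuLeFineMuAt W p := by
  constructor
  · intro hμ
    exact ⟨eulerLossZeroAt_of_muAnZeroAt hμ hp2 hord hirr,
      muLeFineMuAt_of_muAnZeroAt hfine hmodP hp2 hord hirr hμ⟩
  · rintro ⟨hδ, he⟩ N _ f hf
    obtain ⟨κ, hκ, γ, hγ, hγ'⟩ := exists_isCyclotomic_isTopGenerator_isCyclotomicVariable_holds p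
    obtain ⟨I⟩ := Kato2004.nonempty_iwasawaH1Data_holds W p κ γ hκ hγ
    let D : W.SelmerDualData κ γ := W.selmerDualData κ hγ
    haveI : Module.Finite (IwasawaAlgebra p) D.X :=
      WeierstrassCurve.SelmerDualData.module_finite_of_isCyclotomic W κ hκ D hγ
    let Y : W.FineSelmerDualData κ γ := W.fineSelmerDualData κ hγ
    obtain ⟨K, π, hπs, hπ⟩ := hfine W p f κ γ hp2 hord hκ hγ hγ' hf I D Y
    obtain ⟨G₁, hG₁⟩ := exists_iwasawaToPowerSeries_eq_padicLFunction hp2 hord hf hirr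
    have hDt : D.IsTorsion := isTorsion_X_of_package K hord hf
    have hL : padicLFunction f (unitRoot W p : ℚ_[p]) ≠ 0 := padicLFunction_unitRoot_ne_zero hord hf
    have hG0 : G₁ ≠ 0 := by rintro rfl; exact hL (by rw [← hG₁, map_zero])
    have hYf : Module.Finite (IwasawaAlgebra p) Y.X := Module.Finite.of_surjective π hπs
    have hYt : Module.IsTorsion (IwasawaAlgebra p) Y.X := Kato2004.isTorsion_of_surjective π hπs hDt
    have heq : muInvariant p D.X = muInvariant p Y.X :=
      le_antisymm (he κ γ hκ hγ hγ' D Y hYf hYt) (muInvariant_le_of_surjective hDt π hπs)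
    have h0 : muInvariant p (IwasawaAlgebra p ⧸ Ideal.span {G₁}) = 0 :=
      (muAn_eq_zero_iff K hirr hG₁ hL π hπs hπ hDt).mpr ⟨hδ κ γ f hκ hγ hγ' hf I D K, heq⟩
    rw [← hG₁]
    exact exists_norm_coeff_eq_one_of_not_mem_augIdealP
      (not_mem_augIdealP_of_muInvariant_quotient_eq_zero hG0 h0)

/-- **X9 instance** (`ClassX9` supplies `p ≥ 5`, good ordinary, `E[p]` irreducible): on
`Rank1Residual.ClassX9 W p`, `MuAnZeroAt W p ↔ EulerLossZeroAt W p ∧ MuLeFineMuAt W p` modulo F1 and a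
modularity witness.  Hence, per X9 pair, 19630|pair (`μ^an = 0 → μ(X₀) = 0`, with 19629
`μ^an = 0 → μ(X) = 0`) has hypothesis EXACTLY «`δ = 0` for every package ∧ `e = 0`».
[cite: Kato2004Asterisque, §17.13 (pp. 279–280)] -/
theorem muAnZeroAt_iff_eulerLossZero_and_muLeFineMu_X9 (hfine : exists_divisibilityInputs_fineQuotient)
    (hmodP : nonempty_modularParametrizationData) (hX9 : ClassX9 W p) :
    MuAnZeroAt W p ↔ EulerLossZeroAt W p ∧ MuLeFineMuAt W p := by
  obtain ⟨-, hp5, hgood, hap, hirr, -⟩ := hX9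
  have hp2 : p ≠ 2 := by omega
  exact muAnZeroAt_iff_eulerLossZero_and_muLeFineMu hfine hmodP hp2 ⟨hgood, hap⟩ hirr

end PerPair


end Summit.BirchSwinnertonDyer.Rank1Residual.SmallImageMu

end
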